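import Mathlib.Analysis.SpecialFunctions.Pow.Real
import Mathlib.Topology.Instances.ENNReal.Lemmas
import HarnessLib

/-!
# (α'₂) pair programme, bookkeeping: the `ε`-arithmetic of the two-state cut-off argument
# — line `third-law-current-floor`, crux `HardCoreExtension` (stmt-AtomisticToContinuum-11786), lead c1

Pure real / `ℝ≥0∞` arithmetic, no analysis: (i) the lost mass `η = mK + mO` (core + outer shell, both states) is
small once the truncation height `m` is large and the layer kinetic energy is small (`eta_bound_ennreal`); (ii) the
chain `K ≤ (1+32η)·q`, `q ≤ (1+θ)E + A·mO`, `E ≤ Kₘ + 1/(m+1)`, `m·mK ≤ E`, `mO ≤ Cs·mI + Csℓ²·Kl`, `Kl ≤ ε₁` closes to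
`K ≤ Kₘ + ε` for the lead's choice of `θ, η₀, ε₁, m` (`final_ennreal`). [folklore]
-/

noncomputable section

namespace Summit.AtomisticToContinuum.BoseEinsteinCondensation.Cruxes.HardCoreExtension.ThirdLawCurrentFloor

open scoped ENNReal NNReal

namespace AlphaPair

/-! ### Real arithmetic (small lemmas, cheap `nlinarith`) -/

/-- `A·X ≤ Y` for `A = (1+θ⁻¹)C/ℓ²` from the product form `(1+θ)·C·X ≤ Y·θ·ℓ²`. [folklore] -/
theorem coeffA_le {θ C ℓ X Y : ℝ} (hθ : 0 < θ) (hℓ : 0 < ℓ) (h : (1 + θ) * C * X ≤ Y * (θ * ℓ ^ 2)) :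
    (1 + θ⁻¹) * (C / ℓ ^ 2) * X ≤ Y := by
  have hℓ2 : 0 < ℓ ^ 2 := by positivity
  have hid : (1 + θ⁻¹) * (C / ℓ ^ 2) * X = ((1 + θ) * C * X) / (θ * ℓ ^ 2) := by
    field_simp
    ring
  rw [hid, div_le_iff₀ (by positivity)]
  exact h

/-- The lost mass is small: `mK + mO ≤ η₀` from `m·mK ≤ K+1`, the shell bound and the two threshold conditions. [folklore] -/
theorem eta_bound {K mK mO mI kl Cs ℓ a ε₁ η₀ m : ℝ} (hCs : 0 ≤ Cs) (hℓ : 0 < ℓ) (hℓa : ℓ ≤ a)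
    (hm : 0 < m) (hε₁ : 0 ≤ ε₁)
    (hcore : m * mK ≤ K + 1) (hinner : mI ≤ mK) (hshell : mO ≤ Cs * mI + Cs * ℓ ^ 2 * kl) (hkl : kl ≤ ε₁)
    (hm1 : 2 * (1 + Cs) * (K + 1) ≤ η₀ * m) (hε₁a : ε₁ * (2 * (Cs + 1) * (a ^ 2 + 1)) ≤ η₀) :
    mK + mO ≤ η₀ := by
  have hℓ2 : 0 < ℓ ^ 2 := by positivity
  have hℓ2a : ℓ ^ 2 ≤ a ^ 2 := pow_le_pow_left₀ hℓ.le hℓa 2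
  have h1 : Cs * ℓ ^ 2 * kl ≤ Cs * ℓ ^ 2 * ε₁ := mul_le_mul_of_nonneg_left hkl (by positivity)
  have h2 : Cs * ℓ ^ 2 * ε₁ ≤ Cs * a ^ 2 * ε₁ :=
    mul_le_mul_of_nonneg_right (mul_le_mul_of_nonneg_left hℓ2a hCs) hε₁
  have h3 : Cs * mI ≤ Cs * mK := mul_le_mul_of_nonneg_left hinner hCs
  have hmO : mO ≤ Cs * mK + Cs * a ^ 2 * ε₁ := by linarith
  -- `(1+Cs) mK ≤ η₀/2`: multiply by `m`
  have h4 : (1 + Cs) * mK * m ≤ (1 + Cs) * (K + 1) := by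
    have := mul_le_mul_of_nonneg_left hcore (by positivity : (0:ℝ) ≤ 1 + Cs)
    linarith [this]
  have h5 : (1 + Cs) * mK * 2 ≤ η₀ := by
    have h6 : (1 + Cs) * mK * 2 * m ≤ η₀ * m := by nlinarith
    by_contra hcon
    push Not at hcon
    have := mul_lt_mul_of_pos_right hcon hm
    linarith
  -- `Cs a² ε₁ ≤ η₀/2`
  have h7 : Cs * a ^ 2 * ε₁ * 2 ≤ η₀ := by
    have h8 : Cs * a ^ 2 * 2 ≤ 2 * (Cs + 1) * (a ^ 2 + 1) := by nlinarith [sq_nonneg a]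
    have := mul_le_mul_of_nonneg_right h8 hε₁
    linarith
  nlinarith

/-- Term 1 of the final chain: `(1+32η)(1+θ)E ≤ Km + 3ε/8`. [folklore] -/
theorem term1_bound {K Km E θ η η₀ ε m : ℝ} (hKm : Km ≤ K) (hKm0 : 0 ≤ Km) (hθ : 0 < θ) (hη : 0 ≤ η)
    (hηη₀ : η ≤ η₀) (hη₀ : η₀ ≤ 1 / 8) (hm : 0 < m)
    (hE : E ≤ Km + 1 / (m + 1)) (hθK : θ * (8 * (K + 1)) ≤ ε) (hη₀b : η₀ * (256 * (1 + θ) * (K + 1)) ≤ ε)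
    (hm2 : 40 * (1 + θ) ≤ ε * (m + 1)) :
    (1 + 32 * η) * ((1 + θ) * E) ≤ Km + ε / 8 + ε / 8 + ε / 8 := by
  have h32 : 1 + 32 * η ≤ 5 := by linarith
  have h32' : 0 ≤ 1 + 32 * η := by linarith
  have hE' : (1 + θ) * E ≤ (1 + θ) * Km + (1 + θ) / (m + 1) := by
    have := mul_le_mul_of_nonneg_left hE (by positivity : (0:ℝ) ≤ 1 + θ)
    rwa [mul_add, mul_one_div] at this
  have ha : θ * Km ≤ ε / 8 := by
    rw [le_div_iff₀ (by norm_num : (0:ℝ) < 8)]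
    nlinarith [mul_le_mul_of_nonneg_left hKm hθ.le]
  have hK : 0 ≤ K := hKm0.trans hKm
  have hb : 32 * η * ((1 + θ) * Km) ≤ ε / 8 := by
    rw [le_div_iff₀ (by norm_num : (0:ℝ) < 8)]
    have h1 : η * (256 * (1 + θ) * (K + 1)) ≤ ε :=
      le_trans (mul_le_mul_of_nonneg_right hηη₀ (by positivity)) hη₀b
    have h2 : η * (256 * (1 + θ) * Km) ≤ η * (256 * (1 + θ) * (K + 1)) :=
      mul_le_mul_of_nonneg_left (by nlinarith) hη
    nlinarith
  have hc : (1 + 32 * η) * ((1 + θ) / (m + 1)) ≤ ε / 8 := by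
    have h5 : (1 + 32 * η) * ((1 + θ) / (m + 1)) ≤ 5 * ((1 + θ) / (m + 1)) :=
      mul_le_mul_of_nonneg_right h32 (by positivity)
    have h6 : 5 * ((1 + θ) / (m + 1)) ≤ ε / 8 := by
      rw [mul_div_assoc', div_le_div_iff₀ (by positivity) (by norm_num : (0:ℝ) < 8)]
      nlinarith
    linarith
  have hid : (1 + θ) * Km = Km + θ * Km := by ring
  calc (1 + 32 * η) * ((1 + θ) * E) ≤ (1 + 32 * η) * ((1 + θ) * Km + (1 + θ) / (m + 1)) :=
        mul_le_mul_of_nonneg_left hE' h32'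
    _ = (1 + θ) * Km + 32 * η * ((1 + θ) * Km) + (1 + 32 * η) * ((1 + θ) / (m + 1)) := by ring
    _ ≤ Km + ε / 8 + ε / 8 + ε / 8 := by rw [hid]; linarith

/-- Term 2 of the final chain: `5·A·mO ≤ ε/16 + ε/8`, `A = (1+θ⁻¹)C/ℓ²`. [folklore] -/
theorem term2_bound {K mK mO mI kl θ Cs C ℓ ε ε₁ m : ℝ} (hθ : 0 < θ) (hCs : 0 ≤ Cs) (hC : 0 ≤ C) (hℓ : 0 < ℓ)
    (hm : 0 < m) (hε₁ : 0 ≤ ε₁)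
    (hcore : m * mK ≤ K + 1) (hinner : mI ≤ mK) (hshell : mO ≤ Cs * mI + Cs * ℓ ^ 2 * kl) (hkl : kl ≤ ε₁)
    (hm3 : 80 * (1 + θ) * C * Cs * (K + 1) ≤ ε * θ * ℓ ^ 2 * m)
    (hε₁b : ε₁ * (40 * (C * Cs + 1) * (1 + θ)) ≤ ε * θ) :
    5 * ((1 + θ⁻¹) * (C / ℓ ^ 2) * mO) ≤ ε / 16 + ε / 8 := by
  have hℓ2 : 0 < ℓ ^ 2 := by positivity
  have hA : 0 ≤ (1 + θ⁻¹) * (C / ℓ ^ 2) := by positivity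
  have h1 : Cs * ℓ ^ 2 * kl ≤ Cs * ℓ ^ 2 * ε₁ := mul_le_mul_of_nonneg_left hkl (by positivity)
  have h3 : Cs * mI ≤ Cs * mK := mul_le_mul_of_nonneg_left hinner hCs
  have hmO : mO ≤ Cs * mK + Cs * ℓ ^ 2 * ε₁ := by linarith
  -- `A Cs mK ≤ ε/80`
  have hT : (1 + θ⁻¹) * (C / ℓ ^ 2) * (Cs * mK) ≤ ε / 80 := by
    refine coeffA_le hθ hℓ ?_
    -- `(1+θ) C Cs mK ≤ (ε/80) θ ℓ²`: multiply by `m`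
    have h4 : (1 + θ) * C * Cs * mK * m ≤ (1 + θ) * C * Cs * (K + 1) := by
      have := mul_le_mul_of_nonneg_left hcore (by positivity : (0:ℝ) ≤ (1 + θ) * C * Cs)
      linarith [this]
    have h5 : (1 + θ) * C * Cs * mK * m * 80 ≤ ε * θ * ℓ ^ 2 * m := by linarith
    by_contra hcon
    push Not at hcon
    have h6 : ε / 80 * (θ * ℓ ^ 2) * m < (1 + θ) * C * (Cs * mK) * m := mul_lt_mul_of_pos_right hcon hm
    have h7 : ε / 80 * (θ * ℓ ^ 2) * m * 80 = ε * θ * ℓ ^ 2 * m := by ring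
    nlinarith
  -- `A Cs ℓ² ε₁ ≤ ε/40`
  have hU : (1 + θ⁻¹) * (C / ℓ ^ 2) * (Cs * ℓ ^ 2 * ε₁) ≤ ε / 40 := by
    refine coeffA_le hθ hℓ ?_
    have h8 : ε₁ * (40 * (C * Cs) * (1 + θ)) ≤ ε * θ := by
      have : ε₁ * (40 * (C * Cs) * (1 + θ)) ≤ ε₁ * (40 * (C * Cs + 1) * (1 + θ)) :=
        mul_le_mul_of_nonneg_left (by nlinarith) hε₁
      linarith
    have h9 : (1 + θ) * C * (Cs * ℓ ^ 2 * ε₁) * 40 = ε₁ * (40 * (C * Cs) * (1 + θ)) * ℓ ^ 2 := by ring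
    have h10 : ε / 40 * (θ * ℓ ^ 2) * 40 = ε * θ * ℓ ^ 2 := by ring
    nlinarith [mul_le_mul_of_nonneg_right h8 hℓ2.le]
  have hsum : (1 + θ⁻¹) * (C / ℓ ^ 2) * mO ≤ ε / 80 + ε / 40 := by
    calc (1 + θ⁻¹) * (C / ℓ ^ 2) * mO ≤ (1 + θ⁻¹) * (C / ℓ ^ 2) * (Cs * mK + Cs * ℓ ^ 2 * ε₁) :=
          mul_le_mul_of_nonneg_left hmO hA
      _ = (1 + θ⁻¹) * (C / ℓ ^ 2) * (Cs * mK) + (1 + θ⁻¹) * (C / ℓ ^ 2) * (Cs * ℓ ^ 2 * ε₁) := by ring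
      _ ≤ ε / 80 + ε / 40 := add_le_add hT hU
  linarith

/-- The final `ε`-chain in real numbers: `K ≤ Km + ε`. [folklore] -/
theorem final_bound {K Km q E mK mO mI kl θ η η₀ Cs C ℓ ε ε₁ m : ℝ}
    (hKm : Km ≤ K) (hKm0 : 0 ≤ Km) (hθ : 0 < θ) (hη : 0 ≤ η) (hηη₀ : η ≤ η₀) (hη₀ : η₀ ≤ 1 / 8)
    (hCs : 0 ≤ Cs) (hC : 0 ≤ C) (hℓ : 0 < ℓ) (hm : 0 < m) (hε₁ : 0 ≤ ε₁) (hmO : 0 ≤ mO)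
    (hGS : K ≤ (1 + 32 * η) * q) (hq : q ≤ (1 + θ) * E + (1 + θ⁻¹) * (C / ℓ ^ 2) * mO)
    (hE : E ≤ Km + 1 / (m + 1)) (hcore : m * mK ≤ K + 1) (hinner : mI ≤ mK)
    (hshell : mO ≤ Cs * mI + Cs * ℓ ^ 2 * kl) (hkl : kl ≤ ε₁)
    (hθK : θ * (8 * (K + 1)) ≤ ε) (hη₀b : η₀ * (256 * (1 + θ) * (K + 1)) ≤ ε)
    (hm2 : 40 * (1 + θ) ≤ ε * (m + 1)) (hm3 : 80 * (1 + θ) * C * Cs * (K + 1) ≤ ε * θ * ℓ ^ 2 * m)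
    (hε₁b : ε₁ * (40 * (C * Cs + 1) * (1 + θ)) ≤ ε * θ) :
    K ≤ Km + ε := by
  have h32 : 1 + 32 * η ≤ 5 := by linarith
  have h32' : 0 ≤ 1 + 32 * η := by linarith
  have hA : 0 ≤ (1 + θ⁻¹) * (C / ℓ ^ 2) := by positivity
  have hAm : 0 ≤ (1 + θ⁻¹) * (C / ℓ ^ 2) * mO := mul_nonneg hA hmO
  have hchain : K ≤ (1 + 32 * η) * ((1 + θ) * E) + 5 * ((1 + θ⁻¹) * (C / ℓ ^ 2) * mO) := by
    have h1 : (1 + 32 * η) * q ≤ (1 + 32 * η) * ((1 + θ) * E + (1 + θ⁻¹) * (C / ℓ ^ 2) * mO) :=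
      mul_le_mul_of_nonneg_left hq h32'
    have h2 : (1 + 32 * η) * ((1 + θ⁻¹) * (C / ℓ ^ 2) * mO) ≤ 5 * ((1 + θ⁻¹) * (C / ℓ ^ 2) * mO) :=
      mul_le_mul_of_nonneg_right h32 hAm
    have h3 : (1 + 32 * η) * ((1 + θ) * E + (1 + θ⁻¹) * (C / ℓ ^ 2) * mO) =
        (1 + 32 * η) * ((1 + θ) * E) + (1 + 32 * η) * ((1 + θ⁻¹) * (C / ℓ ^ 2) * mO) := by ring
    linarith
  have hT1 := term1_bound hKm hKm0 hθ hη hηη₀ hη₀ hm hE hθK hη₀b hm2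
  have hT2 := term2_bound hθ hCs hC hℓ hm hε₁ hcore hinner hshell hkl hm3 hε₁b
  linarith

/-! ### The same in `ℝ≥0∞` -/

/-- `(mK + mO).toReal ≤ η₀` (and finiteness) from the `ℝ≥0∞` facts of the cut-off argument. [folklore] -/
theorem eta_bound_ennreal {K E mK mO mI Kl : ℝ≥0∞} {Cs ℓ a ε₁ η₀ : ℝ} {m : ℕ}
    (hK : K ≠ ⊤) (hE : E ≤ K + 1) (hCs : 0 ≤ Cs) (hℓ : 0 < ℓ) (hℓa : ℓ ≤ a) (hm : 0 < (m : ℝ)) (hε₁ : 0 < ε₁)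
    (hmK1 : mK ≤ 2) (hmO1 : mO ≤ 2)
    (hcore : (m : ℝ≥0∞) * mK ≤ E) (hinner : mI ≤ mK)
    (hshell : mO ≤ ENNReal.ofReal Cs * mI + ENNReal.ofReal (Cs * ℓ ^ 2) * Kl) (hKl : Kl ≤ ENNReal.ofReal ε₁)
    (hm1 : 2 * (1 + Cs) * (K.toReal + 1) ≤ η₀ * m) (hε₁a : ε₁ * (2 * (Cs + 1) * (a ^ 2 + 1)) ≤ η₀) :
    (mK + mO).toReal ≤ η₀ := by
  have h2 : (2 : ℝ≥0∞) ≠ ⊤ := ENNReal.ofNat_ne_top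
  have hmK : mK ≠ ⊤ := ne_top_of_le_ne_top h2 hmK1
  have hmO : mO ≠ ⊤ := ne_top_of_le_ne_top h2 hmO1
  have hmI : mI ≠ ⊤ := ne_top_of_le_ne_top hmK hinner
  have hKl' : Kl ≠ ⊤ := ne_top_of_le_ne_top ENNReal.ofReal_ne_top hKl
  have hK1 : K + 1 ≠ ⊤ := ENNReal.add_ne_top.2 ⟨hK, ENNReal.one_ne_top⟩
  have hEt : E ≠ ⊤ := ne_top_of_le_ne_top hK1 hE
  have hshtop : ENNReal.ofReal Cs * mI + ENNReal.ofReal (Cs * ℓ ^ 2) * Kl ≠ ⊤ :=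
    ENNReal.add_ne_top.2 ⟨ENNReal.mul_ne_top ENNReal.ofReal_ne_top hmI, ENNReal.mul_ne_top ENNReal.ofReal_ne_top hKl'⟩
  have rcore : (m : ℝ) * mK.toReal ≤ K.toReal + 1 := by
    have := ENNReal.toReal_mono hK1 (hcore.trans hE)
    rwa [ENNReal.toReal_mul, ENNReal.toReal_natCast, ENNReal.toReal_add hK ENNReal.one_ne_top, ENNReal.toReal_one] at this
  have rinner : mI.toReal ≤ mK.toReal := ENNReal.toReal_mono hmK hinner
  have rshell : mO.toReal ≤ Cs * mI.toReal + Cs * ℓ ^ 2 * Kl.toReal := by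
    have := ENNReal.toReal_mono hshtop hshell
    rwa [ENNReal.toReal_add (ENNReal.mul_ne_top ENNReal.ofReal_ne_top hmI)
      (ENNReal.mul_ne_top ENNReal.ofReal_ne_top hKl'), ENNReal.toReal_mul, ENNReal.toReal_mul,
      ENNReal.toReal_ofReal hCs, ENNReal.toReal_ofReal (by positivity)] at this
  have rKl : Kl.toReal ≤ ε₁ := ENNReal.toReal_le_of_le_ofReal hε₁.le hKl
  rw [ENNReal.toReal_add hmK hmO]
  exact eta_bound hCs hℓ hℓa hm hε₁.le rcore rinner rshell rKl hm1 hε₁a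

/-- The final `ε`-chain in `ℝ≥0∞`: `K ≤ Kₘ + ε`. [folklore] -/
theorem final_ennreal {K Km q E mK mO mI Kl : ℝ≥0∞} {θ η η₀ Cs C ℓ ε ε₁ : ℝ} {m : ℕ}
    (hK : K ≠ ⊤) (hKm : Km ≤ K) (hθ : 0 < θ) (hη : 0 ≤ η) (hηη₀ : η ≤ η₀) (hη₀ : η₀ ≤ 1 / 8)
    (hCs : 0 ≤ Cs) (hC : 0 ≤ C) (hℓ : 0 < ℓ) (hm : 0 < (m : ℝ)) (hε : 0 < ε) (hε₁ : 0 < ε₁)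
    (hmK1 : mK ≤ 2) (hmO1 : mO ≤ 2)
    (hGS : K ≤ ENNReal.ofReal (1 + 32 * η) * q)
    (hq : q ≤ ENNReal.ofReal (1 + θ) * E + ENNReal.ofReal ((1 + θ⁻¹) * (C / ℓ ^ 2)) * mO)
    (hE : E ≤ Km + ENNReal.ofReal (1 / ((m : ℝ) + 1))) (hcore : (m : ℝ≥0∞) * mK ≤ E) (hinner : mI ≤ mK)
    (hshell : mO ≤ ENNReal.ofReal Cs * mI + ENNReal.ofReal (Cs * ℓ ^ 2) * Kl) (hKl : Kl ≤ ENNReal.ofReal ε₁)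
    (hθK : θ * (8 * (K.toReal + 1)) ≤ ε) (hη₀b : η₀ * (256 * (1 + θ) * (K.toReal + 1)) ≤ ε)
    (hm2 : 40 * (1 + θ) ≤ ε * ((m : ℝ) + 1)) (hm3 : 80 * (1 + θ) * C * Cs * (K.toReal + 1) ≤ ε * θ * ℓ ^ 2 * m)
    (hε₁b : ε₁ * (40 * (C * Cs + 1) * (1 + θ)) ≤ ε * θ) :
    K ≤ Km + ENNReal.ofReal ε := by
  have h2 : (2 : ℝ≥0∞) ≠ ⊤ := ENNReal.ofNat_ne_top
  have hKmt : Km ≠ ⊤ := ne_top_of_le_ne_top hK hKm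
  have hmK : mK ≠ ⊤ := ne_top_of_le_ne_top h2 hmK1
  have hmO : mO ≠ ⊤ := ne_top_of_le_ne_top h2 hmO1
  have hmI : mI ≠ ⊤ := ne_top_of_le_ne_top hmK hinner
  have hKl' : Kl ≠ ⊤ := ne_top_of_le_ne_top ENNReal.ofReal_ne_top hKl
  have hEtop' : Km + ENNReal.ofReal (1 / ((m : ℝ) + 1)) ≠ ⊤ := ENNReal.add_ne_top.2 ⟨hKmt, ENNReal.ofReal_ne_top⟩
  have hEt : E ≠ ⊤ := ne_top_of_le_ne_top hEtop' hE
  have hA : 0 ≤ (1 + θ⁻¹) * (C / ℓ ^ 2) := by positivity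
  have hqtop' : ENNReal.ofReal (1 + θ) * E + ENNReal.ofReal ((1 + θ⁻¹) * (C / ℓ ^ 2)) * mO ≠ ⊤ :=
    ENNReal.add_ne_top.2 ⟨ENNReal.mul_ne_top ENNReal.ofReal_ne_top hEt, ENNReal.mul_ne_top ENNReal.ofReal_ne_top hmO⟩
  have hqt : q ≠ ⊤ := ne_top_of_le_ne_top hqtop' hq
  have hshtop : ENNReal.ofReal Cs * mI + ENNReal.ofReal (Cs * ℓ ^ 2) * Kl ≠ ⊤ :=
    ENNReal.add_ne_top.2 ⟨ENNReal.mul_ne_top ENNReal.ofReal_ne_top hmI, ENNReal.mul_ne_top ENNReal.ofReal_ne_top hKl'⟩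
  -- reals
  have h32 : 0 ≤ 1 + 32 * η := by positivity
  have rGS : K.toReal ≤ (1 + 32 * η) * q.toReal := by
    have := ENNReal.toReal_mono (ENNReal.mul_ne_top ENNReal.ofReal_ne_top hqt) hGS
    rwa [ENNReal.toReal_mul, ENNReal.toReal_ofReal h32] at this
  have rq : q.toReal ≤ (1 + θ) * E.toReal + (1 + θ⁻¹) * (C / ℓ ^ 2) * mO.toReal := by
    have := ENNReal.toReal_mono hqtop' hq
    rwa [ENNReal.toReal_add (ENNReal.mul_ne_top ENNReal.ofReal_ne_top hEt)
      (ENNReal.mul_ne_top ENNReal.ofReal_ne_top hmO), ENNReal.toReal_mul, ENNReal.toReal_mul,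
      ENNReal.toReal_ofReal (by positivity), ENNReal.toReal_ofReal hA] at this
  have rE : E.toReal ≤ Km.toReal + 1 / ((m : ℝ) + 1) := by
    have := ENNReal.toReal_mono hEtop' hE
    rwa [ENNReal.toReal_add hKmt ENNReal.ofReal_ne_top, ENNReal.toReal_ofReal (by positivity)] at this
  have rcore : (m : ℝ) * mK.toReal ≤ K.toReal + 1 := by
    have h1 : (m : ℝ≥0∞) * mK ≤ K + 1 := by
      calc (m : ℝ≥0∞) * mK ≤ E := hcore
        _ ≤ Km + ENNReal.ofReal (1 / ((m : ℝ) + 1)) := hE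
        _ ≤ K + 1 := add_le_add hKm (by
            rw [← ENNReal.ofReal_one]; exact ENNReal.ofReal_le_ofReal (by
              rw [div_le_one (by positivity)]; linarith))
    have := ENNReal.toReal_mono (ENNReal.add_ne_top.2 ⟨hK, ENNReal.one_ne_top⟩) h1
    rwa [ENNReal.toReal_mul, ENNReal.toReal_natCast, ENNReal.toReal_add hK ENNReal.one_ne_top, ENNReal.toReal_one] at this
  have rinner : mI.toReal ≤ mK.toReal := ENNReal.toReal_mono hmK hinner
  have rshell : mO.toReal ≤ Cs * mI.toReal + Cs * ℓ ^ 2 * Kl.toReal := by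
    have := ENNReal.toReal_mono hshtop hshell
    rwa [ENNReal.toReal_add (ENNReal.mul_ne_top ENNReal.ofReal_ne_top hmI)
      (ENNReal.mul_ne_top ENNReal.ofReal_ne_top hKl'), ENNReal.toReal_mul, ENNReal.toReal_mul,
      ENNReal.toReal_ofReal hCs, ENNReal.toReal_ofReal (by positivity)] at this
  have rKl : Kl.toReal ≤ ε₁ := ENNReal.toReal_le_of_le_ofReal hε₁.le hKl
  have rKm : Km.toReal ≤ K.toReal := ENNReal.toReal_mono hK hKm
  have key : K.toReal ≤ Km.toReal + ε :=
    final_bound rKm ENNReal.toReal_nonneg hθ hη hηη₀ hη₀ hCs hC hℓ hm hε₁.le ENNReal.toReal_nonneg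
      rGS rq rE rcore rinner rshell rKl hθK hη₀b hm2 hm3 hε₁b
  calc K = ENNReal.ofReal K.toReal := (ENNReal.ofReal_toReal hK).symm
    _ ≤ ENNReal.ofReal (Km.toReal + ε) := ENNReal.ofReal_le_ofReal key
    _ = Km + ENNReal.ofReal ε := by rw [ENNReal.ofReal_add ENNReal.toReal_nonneg hε.le, ENNReal.ofReal_toReal hKmt]

end AlphaPair

/-- **Registered landing stub of this support file** (`stub_alphaPairBookkeeping`, = `AlphaPair.final_ennreal` with all binders
explicit): the `ε`-bookkeeping of the two-state cut-off argument in `ℝ≥0∞`. [folklore] -/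
theorem stub_alphaPairBookkeeping :
    ∀ (K Km q E mK mO mI Kl : ℝ≥0∞) (θ η η₀ Cs C ℓ ε ε₁ : ℝ) (m : ℕ),
      K ≠ ⊤ → Km ≤ K → 0 < θ → 0 ≤ η → η ≤ η₀ → η₀ ≤ 1 / 8 → 0 ≤ Cs → 0 ≤ C → 0 < ℓ → 0 < (m : ℝ) → 0 < ε → 0 < ε₁ →
      mK ≤ 2 → mO ≤ 2 → K ≤ ENNReal.ofReal (1 + 32 * η) * q →
      q ≤ ENNReal.ofReal (1 + θ) * E + ENNReal.ofReal ((1 + θ⁻¹) * (C / ℓ ^ 2)) * mO →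
      E ≤ Km + ENNReal.ofReal (1 / ((m : ℝ) + 1)) → (m : ℝ≥0∞) * mK ≤ E → mI ≤ mK →
      mO ≤ ENNReal.ofReal Cs * mI + ENNReal.ofReal (Cs * ℓ ^ 2) * Kl → Kl ≤ ENNReal.ofReal ε₁ →
      θ * (8 * (K.toReal + 1)) ≤ ε → η₀ * (256 * (1 + θ) * (K.toReal + 1)) ≤ ε →
      40 * (1 + θ) ≤ ε * ((m : ℝ) + 1) → 80 * (1 + θ) * C * Cs * (K.toReal + 1) ≤ ε * θ * ℓ ^ 2 * m →
      ε₁ * (40 * (C * Cs + 1) * (1 + θ)) ≤ ε * θ →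
      K ≤ Km + ENNReal.ofReal ε :=
  fun _ _ _ _ _ _ _ _ _ _ _ _ _ _ _ _ _ hK hKm hθ hη hηη₀ hη₀ hCs hC hℓ hm hε hε₁ hmK1 hmO1 hGS hq hE hcore hinner hshell hKl
      hθK hη₀b hm2 hm3 hε₁b =>
    AlphaPair.final_ennreal hK hKm hθ hη hηη₀ hη₀ hCs hC hℓ hm hε hε₁ hmK1 hmO1 hGS hq hE hcore hinner hshell hKl
      hθK hη₀b hm2 hm3 hε₁b

end Summit.AtomisticToContinuum.BoseEinsteinCondensation.Cruxes.HardCoreExtension.ThirdLawCurrentFloor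

end
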